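import Literature.AlgebraicGeometry.Resolution.HasseSchmidtDerivatives
import Mathlib.RingTheory.MvPolynomial.Homogeneous
import Mathlib.Algebra.MvPolynomial.Supported
import Mathlib.RingTheory.MvPolynomial.Basic
import HarnessLib

/-!
# Linear substitutions and Hasse–Schmidt derivatives: the chain rule, elementary tilts

Topic: `Literature/AlgebraicGeometry/Resolution`. For a commutative ring `R` and a finite index
type `σ`, the `R`-algebra endomorphism `lsubst R a : x_i ↦ Σ_j a_{ij} x_j` of `R[x]`
(`a : σ → σ → R`; for `σ = Fin d` this is `linSubst` of `HironakaDirectrixLinear.lean`) and its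
interaction with the Taylor morphism `f ↦ f(x + u)` and the Hasse–Schmidt derivations
`D^{(β)} = hasseDeriv R β` of `HasseSchmidtDerivatives.lean`:

* `homogeneousComponent_lsubst` — linear substitutions are graded;
* **`taylor_lsubst`** — `(f ∘ A)(x + u) = f(Ax + Au)`, i.e. `taylor ∘ lsubst = lsubstTaylor ∘ taylor`
  with `lsubstTaylor` the simultaneous substitution in the `x`- and the `u`-variables;
* **`hasseDeriv_lsubst`** — the chain rule for linear substitutions:
  `D^{(β)}(f ∘ A) = Σ_γ coeff_{u^β}((Au)^γ) · (D^{(γ)} f) ∘ A`, whence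
  **`hasseDeriv_lsubst_mem_map`**: the image under `lsubst a` of a subalgebra stable under all
  `D^{(γ)}` is again stable (used in `DiffStableSubalgebra.lean`);
* `linearForm R v = Σ_j v_j x_j` (`coeff_single_linearForm`, `linearForm_eq_update_add`,
  `linearForm_mem_span`), and the **elementary tilt** `tilt R i₀ v : x_{i₀} ↦ x_{i₀} + Σ_j v_j x_j`,
  `x_i ↦ x_i` (`i ≠ i₀`) (`= lsubst R (tiltMatrix R i₀ v)`): `tilt_X`, `tilt_X_self`,
  `tilt_X_of_ne`, `tilt_linearForm`, the inverse `tilt_comp_tilt_neg` (for `v_{i₀} = 0`),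
  `tilt_eq_self_of_notMem_vars` (polynomials without `x_{i₀}` are fixed) and
  `tilt_mem_supported`.

All statements are [folklore]; the file exists to serve the structure theorem for differentially
stable subalgebras (Hironaka 1970 / Giraud 1975 / Kawanoue 2007 Lemma 3.1.2.1).

## References

* J. Giraud, *Contact maximal en caractéristique positive*, Ann. Sci. ÉNS (4) 8 (1975) 201–234,
  §1 (Taylor morphism, Lemme 1.6). [Giraud1975]
* H. Kawanoue, *Toward resolution of singularities over a field of positive characteristic.
  Part I*, Publ. RIMS 43 (2007) 819–909, Ch. 1. [Kawanoue2007]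
-/

open MvPolynomial

namespace Literature.AlgebraicGeometry.Resolution

section LinSubst

/-! ### Linear substitutions commute with Hasse–Schmidt derivatives up to base change -/

variable {σ : Type*} [Fintype σ] (R : Type*) [CommRing R]

/-- The linear forms `Σ_j a_{ij} x_j` of a linear substitution. [folklore] -/
noncomputable def lsubstFun (a : σ → σ → R) (i : σ) : MvPolynomial σ R := ∑ j, C (a i j) * X j

/-- **The linear substitution `x_i ↦ Σ_j a_{ij} x_j`** as an `R`-algebra endomorphism of
`R[x_1, …, x_n]` (for `σ = Fin d` this is, definitionally, `linSubst R A` of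
`HironakaDirectrixLinear.lean` with `a i j = A i j`; here the index type is arbitrary). [folklore] -/
noncomputable def lsubst (a : σ → σ → R) : MvPolynomial σ R →ₐ[R] MvPolynomial σ R :=
  aeval (lsubstFun R a)

/-- `lsubst a (x_i) = Σ_j a_{ij} x_j`. [folklore] -/
@[simp] theorem lsubst_X (a : σ → σ → R) (i : σ) :
    lsubst R a (X i) = ∑ j, C (a i j) * X j := aeval_X _ _

/-- A linear substitution fixes the constants. [folklore] -/
@[simp] theorem lsubst_C (a : σ → σ → R) (c : R) : lsubst R a (C c) = C c := by
  rw [lsubst, aeval_C]; rfl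

/-- The substituted forms are linear. [folklore] -/
theorem isHomogeneous_lsubstFun (a : σ → σ → R) (i : σ) : (lsubstFun R a i).IsHomogeneous 1 := by
  unfold lsubstFun
  refine IsHomogeneous.sum _ _ _ fun j _ => ?_
  exact (isHomogeneous_X R j).C_mul (a i j)

/-- **A linear substitution preserves the grading**: it commutes with taking homogeneous
components. [folklore] -/
theorem homogeneousComponent_lsubst (a : σ → σ → R) (f : MvPolynomial σ R) (d : ℕ) :
    homogeneousComponent d (lsubst R a f) = lsubst R a (homogeneousComponent d f) := by
  conv_lhs => rw [← sum_homogeneousComponent f, map_sum, map_sum]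
  have hterm : ∀ i ∈ Finset.range (f.totalDegree + 1),
      homogeneousComponent d (lsubst R a (homogeneousComponent i f)) =
        if d = i then lsubst R a (homogeneousComponent i f) else 0 := by
    intro i _
    apply homogeneousComponent_of_mem
    have := (homogeneousComponent_isHomogeneous i f).aeval (lsubstFun R a)
      (isHomogeneous_lsubstFun R a)
    rw [one_mul] at this
    exact this
  rw [Finset.sum_congr rfl hterm, Finset.sum_ite_eq]
  split_ifs with hd
  · rfl
  · rw [Finset.mem_range, not_lt] at hd
    rw [homogeneousComponent_eq_zero _ _ (by omega), map_zero]

/-- The base change `(R[x])[u] → (R[x])[u]` that applies the substitution to the coefficients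
and the substitution (with coefficients `C (C a_{ij})`) to the `u`-variables. [folklore] -/
noncomputable def lsubstTaylor (a : σ → σ → R) :
    MvPolynomial σ (MvPolynomial σ R) →+* MvPolynomial σ (MvPolynomial σ R) :=
  eval₂Hom (C.comp (lsubst R a : MvPolynomial σ R →+* MvPolynomial σ R))
    fun i => MvPolynomial.map C (lsubstFun R a i)

/-- The substituted forms, read with coefficients in `R[x]`. [folklore] -/
theorem map_C_lsubstFun (a : σ → σ → R) (i : σ) :
    MvPolynomial.map (C : R →+* MvPolynomial σ R) (lsubstFun R a i) = ∑ j, C (C (a i j)) * X j := by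
  unfold lsubstFun
  rw [map_sum]
  refine Finset.sum_congr rfl fun j _ => ?_
  rw [map_mul, map_C, map_X]

/-- **Taylor expansion commutes with linear substitutions**: `(f ∘ A)(x + u) = f(Ax + Au)`,
i.e. `taylor (lsubst a f)` is obtained from `taylor f` by substituting in coefficients and in `u`.
[folklore] -/
theorem taylor_lsubst (a : σ → σ → R) (f : MvPolynomial σ R) :
    taylor R (lsubst R a f) = lsubstTaylor R a (taylor R f) := by
  have key : (taylor R (σ := σ)).toRingHom.comp (lsubst R a).toRingHom =
      (lsubstTaylor R a).comp (taylor R (σ := σ)).toRingHom := by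
    refine MvPolynomial.ringHom_ext (fun c => ?_) (fun i => ?_)
    · simp [lsubstTaylor]
    · simp only [RingHom.coe_comp, AlgHom.toRingHom_eq_coe, RingHom.coe_coe, Function.comp_apply,
        lsubst_X, taylor_X, lsubstTaylor, coe_eval₂Hom, eval₂_add, eval₂_C, eval₂_X,
        RingHom.coe_comp, Function.comp_apply, map_C_lsubstFun, map_sum, map_mul, taylor_C,
        lsubst_X]
      rw [Finset.sum_add_distrib.symm]  -- hmm
      refine Finset.sum_congr rfl fun j _ => ?_
      ring
  exact RingHom.congr_fun key f

/-- **Chain rule for Hasse–Schmidt derivatives under a linear substitution**: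
`D^{(β)}(f ∘ A)` is an `R`-linear combination of the `(D^{(γ)} f) ∘ A`. [folklore] -/
theorem hasseDeriv_lsubst (a : σ → σ → R) (β : σ →₀ ℕ) (f : MvPolynomial σ R) :
    hasseDeriv R β (lsubst R a f) =
      ∑ γ ∈ (taylor R f).support,
        coeff β (γ.prod fun i k => lsubstFun R a i ^ k) • lsubst R a (hasseDeriv R γ f) := by
  rw [hasseDeriv_apply, taylor_lsubst]
  conv_lhs => rw [(taylor R f).as_sum, map_sum, coeff_sum]
  refine Finset.sum_congr rfl fun γ _ => ?_
  have hprod : (γ.prod fun i k =>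
      (MvPolynomial.map (C : R →+* MvPolynomial σ R) (lsubstFun R a i)) ^ k) =
      MvPolynomial.map (C : R →+* MvPolynomial σ R) (γ.prod fun i k => lsubstFun R a i ^ k) := by
    rw [Finsupp.prod, Finsupp.prod, map_prod]
    simp only [map_pow]
  rw [lsubstTaylor, eval₂Hom_monomial, ← hasseDeriv_apply]
  simp only [RingHom.coe_comp, RingHom.coe_coe, Function.comp_apply]
  rw [coeff_C_mul, hprod, coeff_map, smul_eq_C_mul, mul_comm]

/-- **The image of a differentially stable subalgebra under a linear substitution is
differentially stable.** [folklore] -/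
theorem hasseDeriv_lsubst_mem_map (a : σ → σ → R) {U : Subalgebra R (MvPolynomial σ R)}
    (hU : ∀ f ∈ U, ∀ β : σ →₀ ℕ, hasseDeriv R β f ∈ U) {f : MvPolynomial σ R} (hf : f ∈ U)
    (β : σ →₀ ℕ) : hasseDeriv R β (lsubst R a f) ∈ U.map (lsubst R a) := by
  rw [hasseDeriv_lsubst]
  refine Subalgebra.sum_mem _ fun γ _ => Subalgebra.smul_mem _ ?_ _
  exact Subalgebra.mem_map.mpr ⟨_, hU f hf γ, rfl⟩

end LinSubst

section Tilt

/-! ### Elementary shears `x_{i₀} ↦ x_{i₀} + Σ_j v_j x_j` and the coefficients of `x_{i₀}^k` -/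

variable {σ : Type*} [Fintype σ] [DecidableEq σ] (R : Type*) [CommRing R]

/-- The linear form `Σ_j v_j x_j` with coefficient vector `v : σ → R` (for `σ = Fin n` over a
field this is `Literature.RingTheory.MvPolynomial.linForm v = Σ v_j • x_j` of `Directrix.lean`,
by `smul_eq_C_mul`). [folklore] -/
noncomputable def linearForm (v : σ → R) : MvPolynomial σ R := ∑ j, C (v j) * X j

omit [DecidableEq σ] in
/-- `Σ (-v_j) x_j = -Σ v_j x_j`. [folklore] -/
@[simp] theorem linearForm_neg (v : σ → R) : linearForm R (-v) = -linearForm R v := by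
  simp [linearForm, Finset.sum_neg_distrib]

omit [DecidableEq σ] in
/-- The linear form with zero coefficients is zero. [folklore] -/
theorem linearForm_eq_zero (v : σ → R) (hv : ∀ j, v j = 0) : linearForm R v = 0 := by
  simp [linearForm, hv]

/-- The `x_j`-coefficient of `Σ_i v_i x_i` is `v_j`. [folklore] -/
theorem coeff_single_linearForm (v : σ → R) (j : σ) :
    coeff (Finsupp.single j 1) (linearForm R v) = v j := by
  rw [linearForm, coeff_sum]
  have : ∀ i ∈ (Finset.univ : Finset σ), coeff (Finsupp.single j 1) (C (v i) * X i) =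
      if i = j then v j else 0 := by
    intro i _
    rw [coeff_C_mul, coeff_X]
    by_cases hij : i = j
    · subst hij; simp
    · rw [if_neg (fun h => hij ((Finsupp.single_left_inj one_ne_zero).mp h)), if_neg hij, mul_zero]
  rw [Finset.sum_congr rfl this, Finset.sum_ite_eq']
  simp

/-- Splitting off the `x_{i₀}`-term of a linear form. [folklore] -/
theorem linearForm_eq_update_add (w : σ → R) (i₀ : σ) :
    linearForm R w = linearForm R (Function.update w i₀ 0) + C (w i₀) * X i₀ := by
  rw [linearForm, linearForm]
  have h : ∀ j ∈ (Finset.univ : Finset σ), C (w j) * X j =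
      C (Function.update w i₀ 0 j) * X j + if j = i₀ then C (w i₀) * X i₀ else 0 := by
    intro j _
    by_cases hj : j = i₀
    · subst hj; simp
    · simp [hj]
  rw [Finset.sum_congr rfl h, Finset.sum_add_distrib, Finset.sum_ite_eq' Finset.univ i₀,
    if_pos (Finset.mem_univ _)]

omit [DecidableEq σ] in
/-- A linear form in the variables of `S` lies in their `R`-span. [folklore] -/
theorem linearForm_mem_span (v : σ → R) (S : Set σ) (hv : ∀ j, j ∉ S → v j = 0) :
    linearForm R v ∈ Submodule.span R (X '' S : Set (MvPolynomial σ R)) := by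
  refine Submodule.sum_mem _ fun j _ => ?_
  by_cases hj : j ∈ S
  · rw [← smul_eq_C_mul]; exact Submodule.smul_mem _ _ (Submodule.subset_span ⟨j, hj, rfl⟩)
  · rw [hv j hj, C_0, zero_mul]; exact zero_mem _

/-- The matrix `δ_{ij} + δ_{i i₀} v_j` of the elementary substitution `tilt i₀ v`. [folklore] -/
def tiltMatrix (i₀ : σ) (v : σ → R) : σ → σ → R :=
  fun i j => (if j = i then 1 else 0) + (if i = i₀ then v j else 0)

/-- **The elementary substitution ("tilt" of the `x_{i₀}`-axis)** `x_{i₀} ↦ x_{i₀} + Σ_j v_j x_j`,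
`x_i ↦ x_i` (`i ≠ i₀`), an `R`-algebra endomorphism of `R[x]` (an automorphism with inverse
`tilt i₀ (-v)` when `v_{i₀} = 0`). Not to be confused with the transposed shear
`y_i ↦ y_i + t_i y_j` (`i ≠ j`) of `Hauser2010.shear`. [folklore] -/
noncomputable def tilt (i₀ : σ) (v : σ → R) : MvPolynomial σ R →ₐ[R] MvPolynomial σ R :=
  lsubst R (tiltMatrix R i₀ v)

/-- `tilt i₀ v` on the variables. [folklore] -/
theorem tilt_X (i₀ : σ) (v : σ → R) (i : σ) :
    tilt R i₀ v (X i) = X i + if i = i₀ then linearForm R v else 0 := by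
  rw [tilt, lsubst_X]
  simp only [tiltMatrix, map_add, add_mul, Finset.sum_add_distrib]
  congr 1
  · rw [Finset.sum_eq_single i (fun j _ hj => by simp [hj]) (by simp)]
    simp
  · split_ifs with h
    · rfl
    · simp

/-- `tilt i₀ v` fixes `x_i`, `i ≠ i₀`. [folklore] -/
theorem tilt_X_of_ne (i₀ : σ) (v : σ → R) {i : σ} (h : i ≠ i₀) : tilt R i₀ v (X i) = X i := by
  rw [tilt_X, if_neg h, add_zero]

/-- `tilt i₀ v (x_{i₀}) = x_{i₀} + Σ_j v_j x_j`. [folklore] -/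
theorem tilt_X_self (i₀ : σ) (v : σ → R) : tilt R i₀ v (X i₀) = X i₀ + linearForm R v := by
  rw [tilt_X, if_pos rfl]

/-- `tilt` fixes the constants. [folklore] -/
@[simp] theorem tilt_C (i₀ : σ) (v : σ → R) (c : R) : tilt R i₀ v (C c) = C c := lsubst_C R _ c

/-- A tilt of the `x_{i₀}`-axis fixes the linear forms not involving `x_{i₀}`. [folklore] -/
theorem tilt_linearForm (i₀ : σ) (w v : σ → R) (hv : v i₀ = 0) :
    tilt R i₀ w (linearForm R v) = linearForm R v := by
  rw [linearForm, map_sum]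
  refine Finset.sum_congr rfl fun j _ => ?_
  rw [map_mul, tilt_C, tilt_X]
  by_cases hj : j = i₀
  · subst hj; simp [hv]
  · rw [if_neg hj, add_zero]

/-- `tilt v ∘ tilt (-v) = id` (for `v_{i₀} = 0`). [folklore] -/
theorem tilt_comp_tilt_neg (i₀ : σ) (v : σ → R) (hv : v i₀ = 0) :
    (tilt R i₀ v).comp (tilt R i₀ (-v)) = AlgHom.id R _ := by
  refine MvPolynomial.algHom_ext fun i => ?_
  rw [AlgHom.comp_apply, AlgHom.id_apply, tilt_X]
  by_cases hi : i = i₀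
  · subst hi
    rw [if_pos rfl, map_add, tilt_X_self, linearForm_neg, map_neg, tilt_linearForm R i v v hv]
    abel
  · rw [if_neg hi, add_zero, tilt_X_of_ne R i₀ v hi]

/-- `tilt i₀ v (tilt i₀ (-v) f) = f` when `v_{i₀} = 0`. [folklore] -/
theorem tilt_tilt_neg (i₀ : σ) (v : σ → R) (hv : v i₀ = 0) (f : MvPolynomial σ R) :
    tilt R i₀ v (tilt R i₀ (-v) f) = f := by
  have := AlgHom.congr_fun (tilt_comp_tilt_neg R i₀ v hv) f
  rwa [AlgHom.comp_apply, AlgHom.id_apply] at this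

/-- `tilt i₀ (-v) (tilt i₀ v f) = f` when `v_{i₀} = 0`. [folklore] -/
theorem tilt_neg_tilt (i₀ : σ) (v : σ → R) (hv : v i₀ = 0) (f : MvPolynomial σ R) :
    tilt R i₀ (-v) (tilt R i₀ v f) = f := by
  have := tilt_tilt_neg R i₀ (-v) (by simp [hv]) f
  rwa [neg_neg] at this

/-- A tilt along `x_{i₀}` fixes every polynomial not involving `x_{i₀}`. [folklore] -/
theorem tilt_eq_self_of_notMem_vars (i₀ : σ) (v : σ → R) {f : MvPolynomial σ R}
    (hf : i₀ ∉ f.vars) : tilt R i₀ v f = f := by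
  have := MvPolynomial.hom_congr_vars (f₁ := (tilt R i₀ v : MvPolynomial σ R →+* MvPolynomial σ R))
    (f₂ := RingHom.id _) (p₁ := f) (p₂ := f) (by ext c; simp) (fun i hi _ => by
      have hne : i ≠ i₀ := fun h => hf (h ▸ hi)
      rw [RingHom.coe_coe, tilt_X_of_ne R i₀ v hne, RingHom.id_apply]) rfl
  simpa using this

/-- A tilt along `x_{i₀}` by a linear form in the variables of `S` preserves `R[x_j : j ∈ S]`.
[folklore] -/
theorem tilt_mem_supported (i₀ : σ) (v : σ → R) {S : Set σ}
    (hv : ∀ j, j ∉ S → v j = 0) {f : MvPolynomial σ R} (hf : f ∈ supported R S) :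
    tilt R i₀ v f ∈ supported R S := by
  have hgen : ∀ j ∈ S, tilt R i₀ v (X j) ∈ supported R S := by
    intro j hj
    rw [tilt_X]
    refine add_mem (Algebra.subset_adjoin ⟨j, hj, rfl⟩) ?_
    split_ifs
    · refine Subalgebra.sum_mem _ fun i _ => ?_
      by_cases hi : i ∈ S
      · exact mul_mem (by rw [← MvPolynomial.algebraMap_eq]; exact Subalgebra.algebraMap_mem _ _)
          (Algebra.subset_adjoin ⟨i, hi, rfl⟩)
      · rw [hv i hi, C_0, zero_mul]; exact zero_mem _
    · exact zero_mem _
  have hmap : (supported R S).map (tilt R i₀ v) ≤ supported R S := by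
    rw [supported_eq_adjoin_X, AlgHom.map_adjoin]
    refine Algebra.adjoin_le ?_
    rintro _ ⟨_, ⟨j, hj, rfl⟩, rfl⟩
    exact hgen j hj
  exact hmap (Subalgebra.mem_map.mpr ⟨f, hf, rfl⟩)

end Tilt

end Literature.AlgebraicGeometry.Resolution
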